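import Literature.AlgebraicGeometry.Modules.PullbackPushforwardDescent
import Literature.AlgebraicGeometry.Motives.AbelianVarietyIsogenyPullbackPushforwardNatural
import Literature.AlgebraicGeometry.Modules.PushforwardTrace
import Summits.HodgeConjecture.HodgeConjecture.Theorems.VHCAbelianSchemesRoadExtJumpLocusLifts
import HarnessLib

/-!
# Road №4 (`VHCAbelianSchemesRoad`), crux stmt-HodgeConjecture-26512 `DiagLocalOfMarkmanPinnedForall` — lens line N′ «nowhere-displaceable»:
# THE DESCENT IDENTITY `(q_*q^*M)^Ḡ ≅ M` ALONG THE QUOTIENT ISOGENY `q : J × Ĵ → Y = (J × Ĵ)∕Ḡ`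

research route conditional on HC_CM; not a corollary; Q11.4-sentence-2 already refuted in dim ≥ 3.

Director-hodge g17 (M5)-lite (R17.79): the descent-identity face of the object residue (N-U) — for a finite locally free `𝒪_Y`-module `M` on
the secant quotient `Y`, the invariants of the canonical action of the kernel translations `Ḡ = Ker q(ℂ)` on `q_*q^*M` are exactly `M`
(Mumford, *Abelian Varieties*, §7 Thm. 4 ∕ §12 Thm. 1). Instance of the general Literature theorem
`Modules.existsUnique_pullbackUnit_app_eq_of_twistAction_invariant` (`Literature/AlgebraicGeometry/Modules/PullbackPushforwardDescent`) at the
Galois charts of core-D gen 0 (`AbelianVariety.exists_chartInvariants_kerTranslation`), with the injectivity of `q♯` obtained from the trace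
(`Modules.algebraUnit_comp_pushforwardTrace`: `Tr ∘ q♯ = deg q ≠ 0` in characteristic `0`, the degree framing `exists_constRank_frames_pushforward_unit_q`).

* `app_toSchemeHom_q_injective` — `q♯ : Γ(V, 𝒪_Y) → Γ(q⁻¹V, 𝒪_{J×Ĵ})` is injective on every open `V`;
* **`existsUnique_pullbackUnit_app_eq_of_kerTranslation_invariant`** — for `M` finite locally free on `Y`, over every open `W`, a section of
  `q_*q^*M` fixed by the action of every kernel translation is `η(m)` for a UNIQUE `m ∈ Γ(W, M)`.

Everything is proved; no `sorry`, no named fact, standard axioms. NOTHING here says (N-U), (S4), the crux, №4, HC_AV, HC_CM or HC holds;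
HC_CM HELD, by name only; infrastructure (width toward the crux = 0). [cite: MumfordAV1970, §7 Thm. 4 (p. 72) and §12 Thm. 1 (p. 111)]
[cite: StacksProject, Tag 0BVH]
-/

noncomputable section

-- `TopCat.Presheaf`/`Scheme.Modules` are not reducible (as in Mathlib's `AlgebraicGeometry/Modules/Sheaf.lean`).
set_option backward.isDefEq.respectTransparency false

open CategoryTheory CategoryTheory.Category AlgebraicGeometry Opposite TopologicalSpace

namespace Summit.HodgeConjecture.HodgeConjecture.Ring2.SemiregularRepresentatives

set_option linter.dupNamespace false -- the cell's namespace repeats the summit name, as in every `Ring2*` file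

namespace NowhereDisplaceable

open Literature.AlgebraicGeometry Literature.AlgebraicGeometry.Motives Literature.AlgebraicGeometry.Motives.AbelianVariety
open Literature.AlgebraicGeometry.Modules
open Summit.HodgeConjecture.HodgeConjecture.Ring2.SemiregularRepresentatives.MoverTrap

/-- Sections of an `ℕ`-multiple of a morphism of `𝒪`-modules: `(n • φ)_U(x) = n • φ_U(x)`. [folklore] -/
private theorem nsmul_app_apply'' {Z : Scheme} {A B : Z.Modules} (φ : A ⟶ B) (n : ℕ) (U : Z.Opens) (x : Γ(A, U)) :
    (n • φ).app U x = n • φ.app U x := by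
  induction n with
  | zero =>
    rw [zero_nsmul, zero_nsmul, Scheme.Modules.Hom.zero_app]
    rfl
  | succ n ih =>
    rw [succ_nsmul, succ_nsmul, Scheme.Modules.Hom.add_app, ← ih]
    rfl

/-- **`q♯` is injective on sections over every open** (`Tr_q ∘ q♯ = deg q • 𝟙` with `deg q ≠ 0`, and `Γ(V, 𝒪_Y)` is a `ℂ`-algebra).
[cite: StacksProject, Tag 0BVH] [cite: MumfordAV1970, §7 Thm. 4 (p. 72)] -/
theorem app_toSchemeHom_q_injective (D : SecantQuotientDatum) (V : D.Y.X.left.Opens) :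
    Function.Injective ((Hom.toSchemeHom D.q).app V) := by
  have h := isFiniteLocallyFree_pushforward_unit_q D
  obtain ⟨n, hn0, hn⟩ := exists_constRank_frames_pushforward_unit_q D
  have key := algebraUnit_comp_pushforwardTrace (Hom.toSchemeHom D.q) h n hn
  intro a b hab
  rw [← sub_eq_zero] at hab ⊢
  rw [← map_sub] at hab
  set c := a - b with hc
  -- `n • c = Tr(q♯ c) = Tr 0 = 0`
  have h1 : (n • 𝟙 (unitModule D.Y.X.left) : unitModule D.Y.X.left ⟶ unitModule D.Y.X.left).app V c = 0 := by
    rw [← key, Scheme.Modules.Hom.comp_app, ConcreteCategory.comp_apply, algebraUnit_app_apply, hab, map_zero]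
  rw [nsmul_app_apply'', Scheme.Modules.Hom.id_app] at h1
  change n • c = 0 at h1
  -- `n` is invertible in the `ℂ`-algebra `Γ(V, 𝒪_Y)`
  let φ : ℂ →+* Γ(D.Y.X.left, V) :=
    (D.Y.X.left.presheaf.map (homOfLE (le_top : V ≤ ⊤)).op).hom.comp ((Scheme.ΓSpecIso (CommRingCat.of ℂ)).inv ≫ D.Y.X.hom.appTop).hom
  have hu : IsUnit ((n : Γ(D.Y.X.left, V))) := by
    have : φ (n : ℂ) = (n : Γ(D.Y.X.left, V)) := map_natCast φ n
    rw [← this]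
    exact (isUnit_iff_ne_zero.mpr (Nat.cast_ne_zero.mpr hn0)).map φ
  rw [nsmul_eq_mul] at h1
  exact (hu.mul_right_eq_zero).mp h1

/-- **THE DESCENT IDENTITY `(q_*q^*M)^Ḡ ≅ M` along the quotient isogeny of a secant–quotient datum**: for a finite locally free `𝒪_Y`-module `M`
and every open `W ⊆ Y`, a section of `q_*q^*M` over `W` fixed by the canonical action (`Modules.twistAction`) of every kernel translation
`t_x`, `x ∈ Ker q(ℂ) = Ḡ`, is the pull-back `η(m)` of a UNIQUE section `m ∈ Γ(W, M)`. [cite: MumfordAV1970, §7 Thm. 4 (p. 72) and §12 Thm. 1 (p. 111)] -/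
theorem existsUnique_pullbackUnit_app_eq_of_kerTranslation_invariant (D : SecantQuotientDatum) (M : D.Y.X.left.Modules)
    (hM : IsFiniteLocallyFree M) (W : D.Y.X.left.Opens)
    (s : Γ((Scheme.Modules.pushforward (Hom.toSchemeHom D.q)).obj ((Scheme.Modules.pullback (Hom.toSchemeHom D.q)).obj M), W))
    (hs : ∀ x : Hom.kerPoints (specOver ℂ ℂ) D.q,
      (twistAction (Hom.toSchemeHom D.q) (kerTranslation D.q) (kerTranslation_comp D.q) M x).app W s = s) :
    ∃! m : Γ(M, W), (pullbackUnit (Hom.toSchemeHom D.q) M).app W m = s := by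
  haveI : IsFinite (Hom.toSchemeHom D.q) := D.isIsogeny_q.2
  haveI : Finite (Hom.kerPoints (specOver ℂ ℂ) D.q) := finite_kerPoints_of_isFinite D.q ℂ
  exact existsUnique_pullbackUnit_app_eq_of_twistAction_invariant (Hom.toSchemeHom D.q) (kerTranslation D.q) (kerTranslation_comp D.q) M hM
    (fun y => by
      obtain ⟨V, hyV, hV, hinv⟩ := exists_chartInvariants_kerTranslation D.q D.isIsogeny_q y
      exact ⟨V, hyV, hV, hinv⟩)
    (fun V _ => app_toSchemeHom_q_injective D V) W s hs

end NowhereDisplaceable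

end Summit.HodgeConjecture.HodgeConjecture.Ring2.SemiregularRepresentatives
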